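import Literature.Topology.PlanarFoliations.SackTrap
import Literature.Topology.PlanarFoliations.SpiralFrame
import Literature.Topology.PlanarFoliations.FrontierLeaves
import Literature.Topology.PlanarFoliations.LeafBase
import Literature.Topology.PlaneTopology.JordanNesting
import Literature.Topology.PlaneTopology.JordanFill
import HarnessLib

/-!
# Sacks at a point of a Jordan trace of leaves: sides, trapped leaves and their limit graphs

Topic: Topology / PlanarFoliations, sequel to `SackTrap.lean` (a leaf crossing the segment of a
Bendixson sack strictly inside has its ω-limit set in the closure of the right side and its α-limit
set in the closure of the left side), `SpiralFrame.lean` (the limit graph of an open leaf),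
`FrontierLeaves.lean`, `JordanNesting.lean`/`JordanFill.lean`. Tools for the terminal analysis of a
terminal essential pattern (a Jordan loop `γ` made of leaf points and punctures, e.g. a simple
separatrix polygon or a compact leaf) hugged from its inside by an open leaf `L`:

* `exists_oneSided`: at a point `xk` of the domain with `ι xk ∈ range γ`, read in a flow box `e`
  in which the trace near `xk` is the plaque of `xk` (`hloc`), if `L ⊆ inside γ` accumulates at
  `xk` then **the points of the box strictly on one side `s` of the plaque are inside `γ` and those
  on the other side outside** — so every leaf inside `γ` crosses the vertical of `xk` near it at
  heights on the side `s` (`sign_of_isCrossing`);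
* `closure_connectedComponentIn_subset`: the closure of a complementary component of a closed
  set lies in the component and the set;
* for a sack `Dk` of `L` whose segment lies in the one-sided window: **a leaf of the limit graph of
  a leaf trapped in the sack lies entirely in the right side or entirely in the left side**
  (`image_leaf_subset_side_of_limGraph`), on the side in whose closure one of its points is
  (`image_leaf_subset_leftSide`, `image_leaf_subset_rightSide`), and a puncture in the closure of
  such a leaf is on the same side (`mem_side_of_mem_closure`).

## References

* C. Camacho, A. Lins Neto, *Geometric Theory of Foliations*, Birkhäuser (1985), Ch. VII §2
  [CamachoLinsNeto1985].
-/

noncomputable section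

open Set Filter Function Metric
open _root_.Topology
open Literature.Topology.FourManifolds Literature.Topology.FourManifolds.Foliation Literature.Topology.PlaneTopology

namespace Literature.Topology.PlanarFoliations

variable {X : Type*} [TopologicalSpace X] [T2Space X] [SecondCountableTopology X] {F : Foliation ℝ X} {ι : X → ℂ}
variable {hbi : IsBiOriented F}

/-! ## Closures of complementary components -/

/-- **The closure of a complementary component of a closed plane set lies in the component and the
set**: deprecated alias of `PlaneTopology.closure_connectedComponentIn_compl_subset`
(`EilenbergCriterion.lean`, same statement). [folklore] -/
@[deprecated PlaneTopology.closure_connectedComponentIn_compl_subset (since := "2026-08-16")]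
alias closure_connectedComponentIn_subset := PlaneTopology.closure_connectedComponentIn_compl_subset

/-! ## One-sidedness at a point of the trace -/

section OneSided

variable {γ : ℝ → ℂ} (hJ : IsJordanLoop γ) {y₀ : X} (hLU : ι '' F.leaf y₀ ⊆ IsJordanLoop.inside γ)
  {xk : X} (hk : ι xk ∈ range γ) {e : OpenPartialHomeomorph X (ℝ × ℝ)} (he : e ∈ F.atlas)
  (hloc : ∃ ε > 0, ∀ x', ι x' ∈ range γ → x' ∈ e.source →
    |(e x').1 - (e xk).1| < ε → |(e x').2 - (e xk).2| < ε → (e x').2 = (e xk).2)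

include hJ hLU hk he hloc in
omit [T2Space X] [SecondCountableTopology X] in
/-- **One-sidedness of the inside at a point of the trace.** If the open leaf `L ⊆ inside γ` has
`ι xk` in the closure of its image, there are a sign `s = ±1` and `ε > 0` such that the points of
the box of size `ε` about `xk` at heights on the side `s` of the plaque of `xk` are inside `γ`, and
those on the other side are not. [folklore] -/
theorem exists_oneSided (hι : IsOpenEmbedding ι) (hxke : xk ∈ e.source) (hcl : ι xk ∈ closure (ι '' F.leaf y₀)) :
    ∃ s : ℝ, (s = 1 ∨ s = -1) ∧ ∃ ε > 0,
      (∀ u t, |u - (e xk).1| < ε → |t - (e xk).2| < ε → 0 < s * (t - (e xk).2) → ι (e.symm (u, t)) ∈ IsJordanLoop.inside γ) ∧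
      (∀ u t, |u - (e xk).1| < ε → |t - (e xk).2| < ε → 0 < -s * (t - (e xk).2) → ι (e.symm (u, t)) ∉ IsJordanLoop.inside γ) := by
  obtain ⟨ε, hε, hplaque⟩ := hloc
  set u₀ := (e xk).1 with hu₀
  set t₀ := (e xk).2 with ht₀
  have hιc := hι.continuous
  have htarget : ∀ p : ℝ × ℝ, p ∈ e.target := fun p ↦ by rw [F.target_eq e he]; exact mem_univ _
  have hsymm_src : ∀ p : ℝ × ℝ, e.symm p ∈ e.source := fun p ↦ e.map_target (htarget p)
  have he_symm : ∀ p : ℝ × ℝ, e (e.symm p) = p := fun p ↦ e.right_inv (htarget p)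
  have hxk : e.symm (u₀, t₀) = xk := by rw [show (u₀, t₀) = e xk from rfl, e.left_inv hxke]
  set Φ : ℝ × ℝ → ℂ := fun p ↦ ι (e.symm p) with hΦ
  have hcont : Continuous Φ := hιc.comp (SackData.continuous_symm (F := F) he)
  -- the half boxes, off the trace, each inside or outside
  set Hp : Set ℂ := Φ '' (Ioo (u₀ - ε) (u₀ + ε) ×ˢ Ioo t₀ (t₀ + ε)) with hHp
  set Hm : Set ℂ := Φ '' (Ioo (u₀ - ε) (u₀ + ε) ×ˢ Ioo (t₀ - ε) t₀) with hHm
  have hoff : ∀ u t, u ∈ Ioo (u₀ - ε) (u₀ + ε) → t ∈ Ioo (t₀ - ε) (t₀ + ε) → t ≠ t₀ → Φ (u, t) ∉ range γ := by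
    intro u t hu ht htne hmem
    have h := hplaque (e.symm (u, t)) hmem (hsymm_src _)
      (by rw [he_symm]; exact abs_sub_lt_iff.2 ⟨by linarith [hu.2], by linarith [hu.1]⟩)
      (by rw [he_symm]; exact abs_sub_lt_iff.2 ⟨by linarith [ht.2], by linarith [ht.1]⟩)
    rw [he_symm] at h
    exact htne h
  have hside : ∀ {S : Set ℂ}, IsPreconnected S → S ⊆ (range γ)ᶜ →
      S ⊆ IsJordanLoop.inside γ ∨ S ⊆ IsJordanLoop.outside γ := fun {S} hS hSr ↦
    hS.subset_or_subset hJ.isOpen_inside hJ.isOpen_outside IsJordanLoop.disjoint_inside_outside fun z hz ↦ by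
      by_cases h : z ∈ IsJordanLoop.inside γ
      · exact Or.inl h
      · exact Or.inr ((IsJordanLoop.mem_outside_iff_not_mem_inside (hSr hz)).2 h)
  have hHp_side := hside (((convex_Ioo _ _).prod (convex_Ioo _ _)).isPreconnected.image _ hcont.continuousOn)
    (by rintro _ ⟨⟨u, t⟩, ⟨hu, ht⟩, rfl⟩; exact hoff u t hu ⟨by linarith [ht.1], ht.2⟩ ht.1.ne')
  have hHm_side := hside (((convex_Ioo _ _).prod (convex_Ioo _ _)).isPreconnected.image _ hcont.continuousOn)
    (by rintro _ ⟨⟨u, t⟩, ⟨hu, ht⟩, rfl⟩; exact hoff u t hu ⟨ht.1, by linarith [ht.2]⟩ ht.2.ne)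
  -- the whole box is not in the fill
  have hopen : IsOpen (Φ '' (Ioo (u₀ - ε) (u₀ + ε) ×ˢ Ioo (t₀ - ε) (t₀ + ε))) :=
    (isOpenEmbedding_symm he hι).isOpenMap _ (isOpen_Ioo.prod isOpen_Ioo)
  have hxkmem : ι xk ∈ Φ '' (Ioo (u₀ - ε) (u₀ + ε) ×ˢ Ioo (t₀ - ε) (t₀ + ε)) :=
    ⟨(u₀, t₀), ⟨⟨by linarith, by linarith⟩, ⟨by linarith, by linarith⟩⟩, by simp only [hΦ]; rw [hxk]⟩
  have hnotboth : ¬ (Hp ⊆ IsJordanLoop.inside γ ∧ Hm ⊆ IsJordanLoop.inside γ) := by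
    rintro ⟨hp, hm⟩
    have hbox : Φ '' (Ioo (u₀ - ε) (u₀ + ε) ×ˢ Ioo (t₀ - ε) (t₀ + ε)) ⊆ IsJordanLoop.fill γ := by
      rintro _ ⟨⟨u', t'⟩, ⟨hu', ht'⟩, rfl⟩
      rcases lt_trichotomy t' t₀ with hlt | heq | hgt
      · exact Or.inr (hm ⟨(u', t'), ⟨hu', ht'.1, hlt⟩, rfl⟩)
      · -- on the plaque: a limit of points of `Hp`
        rw [heq]
        rw [IsJordanLoop.fill, union_comm, ← hJ.closure_inside_eq]
        have hc : Tendsto (fun n : ℕ ↦ t₀ + ε / ((n : ℝ) + 2)) atTop (𝓝 t₀) := by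
          have h1 : Tendsto (fun n : ℕ ↦ ε * (1 / ((n : ℝ) + 1))) atTop (𝓝 (ε * 0)) :=
            tendsto_const_nhds.mul tendsto_one_div_add_atTop_nhds_zero_nat
          rw [mul_zero] at h1
          have h2 : Tendsto (fun n : ℕ ↦ ε / ((n : ℝ) + 2)) atTop (𝓝 0) :=
            squeeze_zero (fun n ↦ by positivity) (fun n ↦ by
              rw [mul_one_div]; exact div_le_div_of_nonneg_left hε.le (by positivity) (by linarith)) h1
          simpa using tendsto_const_nhds.add h2
        refine mem_closure_of_tendsto ((hcont.tendsto _).comp (tendsto_const_nhds.prodMk_nhds hc))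
          (Eventually.of_forall fun n ↦ hp ⟨(u', t₀ + ε / ((n : ℝ) + 2)), ⟨hu', ?_, ?_⟩, rfl⟩)
        · show t₀ < t₀ + ε / ((n : ℝ) + 2); have : 0 < ε / ((n : ℝ) + 2) := by positivity
          linarith
        · show t₀ + ε / ((n : ℝ) + 2) < t₀ + ε
          have : ε / ((n : ℝ) + 2) < ε := div_lt_self hε (by linarith [n.cast_nonneg (α := ℝ)])
          linarith
      · exact Or.inr (hp ⟨(u', t'), ⟨hu', hgt, ht'.2⟩, rfl⟩)
    have hint : ι xk ∈ interior (IsJordanLoop.fill γ) := interior_maximal hbox hopen hxkmem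
    rw [hJ.interior_fill] at hint
    exact hint.1 hk
  -- a point of `L` in the box, off the plaque of `xk`
  obtain ⟨z, ⟨⟨u, t⟩, ⟨hu, ht⟩, rfl⟩, ⟨x, hxL, hxz⟩⟩ := (mem_closure_iff_nhds.1 hcl) _ (hopen.mem_nhds hxkmem)
  have hx : x = e.symm (u, t) := hι.injective hxz
  have htne : t ≠ t₀ := by
    intro htt
    have hxp : x ∈ plaque e t₀ := by rw [hx, ← htt]; exact F.symm_mem_plaque he u t
    have hxkL : xk ∈ F.leaf y₀ := by
      rw [← leaf_eq_of_mem hxL]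
      exact (F.samePlaque_of_mem_plaque he hxp ⟨hxke, rfl⟩).mem_leaf
    exact (hLU ⟨xk, hxkL, rfl⟩).1 hk
  have hzin : Φ (u, t) ∈ IsJordanLoop.inside γ := hLU ⟨x, hxL, by rw [hx]⟩
  have hdis := IsJordanLoop.disjoint_inside_outside (γ := γ)
  rcases lt_or_gt_of_ne htne with hlt | hgt
  · -- `L` below: `s = -1`
    have hm : Hm ⊆ IsJordanLoop.inside γ := by
      rcases hHm_side with h | h
      · exact h
      · exact absurd (h ⟨(u, t), ⟨hu, ht.1, hlt⟩, rfl⟩) fun h' ↦ disjoint_left.1 hdis hzin h'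
    have hp : Hp ⊆ IsJordanLoop.outside γ := by
      rcases hHp_side with h | h
      · exact absurd ⟨h, hm⟩ hnotboth
      · exact h
    refine ⟨-1, Or.inr rfl, ε, hε, fun u' t' hu' ht' hst ↦ hm ⟨(u', t'), ⟨?_, ?_, by linarith⟩, rfl⟩,
      fun u' t' hu' ht' hst hin ↦ disjoint_left.1 hdis hin (hp ⟨(u', t'), ⟨?_, by linarith, ?_⟩, rfl⟩)⟩
    · exact abs_sub_lt_iff.1 hu' |> fun h ↦ ⟨by linarith [h.2], by linarith [h.1]⟩
    · exact abs_sub_lt_iff.1 ht' |> fun h ↦ by linarith [h.2]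
    · exact abs_sub_lt_iff.1 hu' |> fun h ↦ ⟨by linarith [h.2], by linarith [h.1]⟩
    · exact abs_sub_lt_iff.1 ht' |> fun h ↦ by linarith [h.1]
  · -- `L` above: `s = 1`
    have hp : Hp ⊆ IsJordanLoop.inside γ := by
      rcases hHp_side with h | h
      · exact h
      · exact absurd (h ⟨(u, t), ⟨hu, hgt, ht.2⟩, rfl⟩) fun h' ↦ disjoint_left.1 hdis hzin h'
    have hm : Hm ⊆ IsJordanLoop.outside γ := by
      rcases hHm_side with h | h
      · exact absurd ⟨hp, h⟩ hnotboth
      · exact h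
    refine ⟨1, Or.inl rfl, ε, hε, fun u' t' hu' ht' hst ↦ hp ⟨(u', t'), ⟨?_, by linarith, ?_⟩, rfl⟩,
      fun u' t' hu' ht' hst hin ↦ disjoint_left.1 hdis hin (hm ⟨(u', t'), ⟨?_, ?_, by linarith⟩, rfl⟩)⟩
    · exact abs_sub_lt_iff.1 hu' |> fun h ↦ ⟨by linarith [h.2], by linarith [h.1]⟩
    · exact abs_sub_lt_iff.1 ht' |> fun h ↦ by linarith [h.1]
    · exact abs_sub_lt_iff.1 hu' |> fun h ↦ ⟨by linarith [h.2], by linarith [h.1]⟩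
    · exact abs_sub_lt_iff.1 ht' |> fun h ↦ by linarith [h.2]

end OneSided

/-! ## Leaves are equal or disjoint -/

omit [T2Space X] [SecondCountableTopology X] in
/-- Two leaves are disjoint unless a point of one lies in the other. [folklore] -/
theorem disjoint_leaf_of_not_mem {a b : X} (h : a ∉ F.leaf b) : Disjoint (F.leaf a) (F.leaf b) := by
  refine disjoint_left.2 fun w hwa hwb ↦ h ?_
  rw [← leaf_eq_of_mem hwb, mem_leaf_comm]
  exact hwa

omit [T2Space X] [SecondCountableTopology X] in
/-- The image of a leaf is preconnected. [folklore] -/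
theorem isPreconnected_image_leaf (hιc : Continuous ι) (y : X) : IsPreconnected (ι '' F.leaf y) := by
  have h : ι '' F.leaf y = range fun q : F.Leaf y ↦ ι (Leaf.pt q) := by
    ext z
    exact ⟨by rintro ⟨w, hw, rfl⟩; exact ⟨Leaf.mk w hw, rfl⟩, by rintro ⟨q, rfl⟩; exact ⟨_, q.2, rfl⟩⟩
  rw [h]
  exact (isConnected_range (hιc.comp (Leaf.continuous_coe F y))).isPreconnected

/-! ## Leaves of the limit graph of a trapped leaf lie on one side -/

namespace StarData

variable {B : Type*} [NormedAddCommGroup B] {M : Type*} [TopologicalSpace M] {T : Foliation B M} {g : ℂ → M}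
variable (D : StarData F ι T g) (hbi) (hι : IsOpenEmbedding ι) {C : Set ℂ} (hC : IsCompact C) (hCΩ : C ⊆ D.Ω)
  {xt : X} [NoncompactSpace (F.Leaf xt)] (hmem : ∀ q : F.Leaf xt, ι (Leaf.pt q) ∈ C)
  {y₀ : X} [NoncompactSpace (F.Leaf y₀)] {e : OpenPartialHomeomorph X (ℝ × ℝ)} {u₀ : ℝ}
  (Dk : SackData hbi y₀ e u₀) (he : e ∈ F.atlas) (hdisj : Disjoint (F.leaf xt) (F.leaf y₀))
  {c : F.Leaf xt} (hc : IsCrossing e u₀ c) (hct : ht e c ∈ Ioo Dk.tlo Dk.thi)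
  (hLreg : ∃ z ∈ omegaSet hbi ι y₀ ∪ alphaSet hbi ι y₀, z ∈ range ι)

include hι hC hCΩ hmem hLreg in
/-- **The hugging leaf is not in the limit graph of the trapped leaf**: a leaf with a regular limit
point is not a separatrix. [folklore] -/
theorem not_mem_leaf_of_mem_limGraph {y' : X} (hy' : ι y' ∈ limGraph hbi ι xt) :
    y' ∉ F.leaf y₀ := by
  intro hy'L
  obtain ⟨hωα, y₁, hy₁, hnc⟩ := hy'
  rw [hι.injective hy₁] at hnc
  obtain ⟨z, hz, hzr⟩ := hLreg
  have hP : z ∈ D.P := by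
    have key : ∀ v w : ℂ, v ∈ D.P → w ∈ D.P → (haveI := noncompactSpace_leaf_of_not_isCompact' hnc;
        omegaSet hbi ι y' = {v} ∧ alphaSet hbi ι y' = {w}) → z ∈ D.P := by
      intro v w hv hw h
      haveI := noncompactSpace_leaf_of_not_isCompact' hnc
      rw [← omegaSet_eq_of_mem_leaf (hbi := hbi) (ι := ι) hy'L, ← alphaSet_eq_of_mem_leaf (hbi := hbi) (ι := ι) hy'L] at hz
      rcases hz with hz | hz
      · rw [h.1] at hz; rw [mem_singleton_iff.1 hz]; exact hv
      · rw [h.2] at hz; rw [mem_singleton_iff.1 hz]; exact hw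
    rcases hωα with h | h
    · obtain ⟨_, ⟨v, hv, hω, -⟩, ⟨w, hw, hα, -⟩⟩ :=
        (D.toPunctureData.isCompact_or_of_mem_omegaSet hι hC hCΩ hmem h).resolve_left hnc
      exact key v w hv hw ⟨hω, hα⟩
    · obtain ⟨_, ⟨v, hv, hω, -⟩, ⟨w, hw, hα, -⟩⟩ :=
        (D.toPunctureData.isCompact_or_of_mem_alphaSet hι hC hCΩ hmem h).resolve_left hnc
      exact key v w hv hw ⟨hω, hα⟩
  rw [D.range_eq] at hzr
  exact hzr.2 hP

include hι hC hCΩ hmem hLreg hdisj hc hct in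
/-- **A leaf of the limit graph of a trapped leaf lies entirely in the right side or entirely in
the left side of the sack.** [folklore] -/
theorem image_leaf_subset_side_of_limGraph {y' : X} (hy' : ι y' ∈ limGraph hbi ι xt) :
    ι '' F.leaf y' ⊆ Dk.rightSide he ι ∨ ι '' F.leaf y' ⊆ Dk.leftSide he ι := by
  have hιc := hι.continuous
  have hιi := hι.injective
  obtain ⟨hωα, y₁, hy₁, hnc⟩ := id hy'
  rw [hιi hy₁] at hnc
  haveI : NoncompactSpace (F.Leaf y') := noncompactSpace_leaf_of_not_isCompact' hnc
  have hdisj' : Disjoint (F.leaf y') (F.leaf y₀) :=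
    disjoint_leaf_of_not_mem (D.not_mem_leaf_of_mem_limGraph hbi hι hC hCΩ hmem hLreg hy')
  have hTc : IsClosed (ι '' Dk.traceX) := ((Dk.isCompact_traceX he).image hιc).isClosed
  have hRo : IsOpen (Dk.rightSide he ι) := hTc.isOpen_compl.connectedComponentIn
  have hLo : IsOpen (Dk.leftSide he ι) := hTc.isOpen_compl.connectedComponentIn
  -- the leaf lies in the closure of one side
  have hcl : ι '' F.leaf y' ⊆ closure (Dk.rightSide he ι) ∨ ι '' F.leaf y' ⊆ closure (Dk.leftSide he ι) := by
    rcases hωα with h | h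
    · left
      rintro _ ⟨w, hw, rfl⟩
      exact Dk.omegaSet_subset_closure_rightSide he hι hdisj hc hct (mem_omegaSet_of_mem_leaf hι h hw)
    · right
      rintro _ ⟨w, hw, rfl⟩
      exact Dk.alphaSet_subset_closure_leftSide he hι hdisj hc hct (mem_alphaSet_of_mem_leaf hι h hw)
  -- no common point of the two sides
  have hRL : ∀ {z}, z ∈ Dk.rightSide he ι → z ∈ Dk.leftSide he ι → False := fun {z} hzR hzL ↦
    Dk.rightSide_ne_leftSide he hι (by
      rw [SackData.rightSide] at hzR ⊢; rw [SackData.leftSide] at hzL ⊢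
      rw [connectedComponentIn_eq hzR, connectedComponentIn_eq hzL])
  have hclRL : ∀ {z}, z ∈ closure (Dk.rightSide he ι) → z ∉ Dk.leftSide he ι := fun {z} hz hzL ↦ by
    obtain ⟨w, hwL, hwR⟩ := mem_closure_iff_nhds.1 hz _ (hLo.mem_nhds hzL)
    exact hRL hwR hwL
  have hclLR : ∀ {z}, z ∈ closure (Dk.leftSide he ι) → z ∉ Dk.rightSide he ι := fun {z} hz hzR ↦ by
    obtain ⟨w, hwR, hwL⟩ := mem_closure_iff_nhds.1 hz _ (hRo.mem_nhds hzR)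
    exact hRL hwR hwL
  -- the leaf misses the sack boundary
  have hoff : Disjoint (F.leaf y') Dk.traceX := by
    refine disjoint_left.2 fun w hw hwT ↦ ?_
    set q : F.Leaf y' := Leaf.mk w hw with hq
    obtain ⟨hcr, hqT⟩ := Dk.isCrossing_of_mem_traceX he hιi hdisj' (s := q) ⟨w, hwT, rfl⟩
    have hqt := Dk.ht_mem_Ioo_of_isCrossing hdisj' hcr hqT
    -- points of the leaf just right and just left of the crossing
    obtain ⟨q₁, hq₁⟩ := ((frequently_leafLT_right (hbi := hbi) q).and_eventually
      (Dk.eventually_mem_rightSide_after_of_isCrossing he hιc hιi hcr hqt)).exists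
    obtain ⟨q₂, hq₂⟩ := ((frequently_leafLT_left (hbi := hbi) q).and_eventually
      (Dk.eventually_mem_leftSide_before_of_isCrossing he hιc hιi hcr hqt)).exists
    have h₁ : ι (Leaf.pt q₁) ∈ Dk.rightSide he ι := hq₁.2 hq₁.1
    have h₂ : ι (Leaf.pt q₂) ∈ Dk.leftSide he ι := hq₂.2 hq₂.1
    rcases hcl with h | h
    · exact hclRL (h ⟨_, q₂.2, rfl⟩) h₂
    · exact hclLR (h ⟨_, q₁.2, rfl⟩) h₁
  have hsub : ι '' F.leaf y' ⊆ (ι '' Dk.traceX)ᶜ := Dk.image_subset_compl hιi hoff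
  have hpre : IsPreconnected (ι '' F.leaf y') := isPreconnected_image_leaf hιc y'
  have hy'L : ι y' ∈ ι '' F.leaf y' := ⟨y', F.mem_leaf_self y', rfl⟩
  have hy'T : ι y' ∉ ι '' Dk.traceX := hsub hy'L
  -- the point `ι y'` itself is on one side
  rcases hcl with h | h
  · have hR : ι y' ∈ Dk.rightSide he ι :=
      ((closure_connectedComponentIn_compl_subset hTc _) (h hy'L)).resolve_right hy'T
    left
    have := hpre.subset_connectedComponentIn hy'L hsub
    unfold SackData.rightSide at hR ⊢
    rw [connectedComponentIn_eq hR]; exact this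
  · have hL : ι y' ∈ Dk.leftSide he ι :=
      ((closure_connectedComponentIn_compl_subset hTc _) (h hy'L)).resolve_right hy'T
    right
    have := hpre.subset_connectedComponentIn hy'L hsub
    unfold SackData.leftSide at hL ⊢
    rw [connectedComponentIn_eq hL]; exact this

include hι hC hCΩ hmem hLreg hdisj hc hct in
/-- A leaf of the limit graph with a point in the closure of the left side lies in the left side.
[folklore] -/
theorem image_leaf_subset_leftSide {y' : X} (hy' : ι y' ∈ limGraph hbi ι xt) (hcl : ι y' ∈ closure (Dk.leftSide he ι)) :
    ι '' F.leaf y' ⊆ Dk.leftSide he ι := by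
  have hTc : IsClosed (ι '' Dk.traceX) := ((Dk.isCompact_traceX he).image hι.continuous).isClosed
  have hRo : IsOpen (Dk.rightSide he ι) := hTc.isOpen_compl.connectedComponentIn
  rcases D.image_leaf_subset_side_of_limGraph hbi hι hC hCΩ hmem Dk he hdisj hc hct hLreg hy' with h | h
  · exfalso
    have hR := h ⟨y', F.mem_leaf_self y', rfl⟩
    obtain ⟨w, hwR, hwL⟩ := mem_closure_iff_nhds.1 hcl _ (hRo.mem_nhds hR)
    exact Dk.rightSide_ne_leftSide he hι (by
      rw [SackData.rightSide] at hwR ⊢; rw [SackData.leftSide] at hwL ⊢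
      rw [connectedComponentIn_eq hwR, connectedComponentIn_eq hwL])
  · exact h

include hι hC hCΩ hmem hLreg hdisj hc hct in
/-- A leaf of the limit graph with a point in the closure of the right side lies in the right side.
[folklore] -/
theorem image_leaf_subset_rightSide {y' : X} (hy' : ι y' ∈ limGraph hbi ι xt) (hcl : ι y' ∈ closure (Dk.rightSide he ι)) :
    ι '' F.leaf y' ⊆ Dk.rightSide he ι := by
  have hTc : IsClosed (ι '' Dk.traceX) := ((Dk.isCompact_traceX he).image hι.continuous).isClosed
  have hLo : IsOpen (Dk.leftSide he ι) := hTc.isOpen_compl.connectedComponentIn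
  rcases D.image_leaf_subset_side_of_limGraph hbi hι hC hCΩ hmem Dk he hdisj hc hct hLreg hy' with h | h
  · exact h
  · exfalso
    have hL := h ⟨y', F.mem_leaf_self y', rfl⟩
    obtain ⟨w, hwL, hwR⟩ := mem_closure_iff_nhds.1 hcl _ (hLo.mem_nhds hL)
    exact Dk.rightSide_ne_leftSide he hι (by
      rw [SackData.rightSide] at hwR ⊢; rw [SackData.leftSide] at hwL ⊢
      rw [connectedComponentIn_eq hwR, connectedComponentIn_eq hwL])

end StarData

/-! ## Punctures in the closure of a side -/

namespace SackData

variable {y₀ : X} [NoncompactSpace (F.Leaf y₀)] {e : OpenPartialHomeomorph X (ℝ × ℝ)} {u₀ : ℝ}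
  (Dk : SackData hbi y₀ e u₀) (he : e ∈ F.atlas) (hι : IsOpenEmbedding ι)

include he hι in
/-- **A point off the domain in the closure of a set of the left side is in the left side.**
[folklore] -/
theorem mem_leftSide_of_mem_closure {A : Set ℂ} (hA : A ⊆ Dk.leftSide he ι) {w : ℂ} (hw : w ∈ closure A) (hwι : w ∉ range ι) :
    w ∈ Dk.leftSide he ι := by
  have hTc : IsClosed (ι '' Dk.traceX) := ((Dk.isCompact_traceX he).image hι.continuous).isClosed
  have h := (closure_connectedComponentIn_compl_subset hTc _) (closure_mono hA hw)
  exact h.resolve_right fun ⟨x, _, hx⟩ ↦ hwι ⟨x, hx⟩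

include he hι in
/-- **A point off the domain in the closure of a set of the right side is in the right side.**
[folklore] -/
theorem mem_rightSide_of_mem_closure {A : Set ℂ} (hA : A ⊆ Dk.rightSide he ι) {w : ℂ} (hw : w ∈ closure A) (hwι : w ∉ range ι) :
    w ∈ Dk.rightSide he ι := by
  have hTc : IsClosed (ι '' Dk.traceX) := ((Dk.isCompact_traceX he).image hι.continuous).isClosed
  have h := (closure_connectedComponentIn_compl_subset hTc _) (closure_mono hA hw)
  exact h.resolve_right fun ⟨x, _, hx⟩ ↦ hwι ⟨x, hx⟩

end SackData

end Literature.Topology.PlanarFoliations
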